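import Summits.AtomisticToContinuum.HydrodynamicLimit.Theses.ImplosionDichotomy
import Summits.AtomisticToContinuum.HydrodynamicLimit.Theorems.ImplosionDichotomyTypeOneIdealImplosionHolds

/-!
# `ImplosionDichotomy.TypeOneIdealImplosion` — closing file against the route decl (stmt-AtomisticToContinuum-15146)

Route `ImplosionDichotomy`, support item stmt-AtomisticToContinuum-15146 (`TypeOneIdealImplosion`: smooth positive
profiles on `𝕋³` and a classical monatomic-ideal-gas (`σ = 0`) solution on `[0, T₁)` with the reference data,
isentropic, with Type-I gradient bounds, polynomial bounds on all derivatives of order `≤ 6`, a polynomial density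
floor and polynomial core growth).

The item's unconditional proof is ALREADY in the tree: `typeOneIdealImplosion_holds`
(`ImplosionDichotomyTypeOneIdealImplosionHolds.lean`: BCG shooting at `γ = 5/3` through the 32 kernel-certified
window bricks `LeftTMW0 … LeftTMW31`, exact self-similar core, backward exterior solution, domain of dependence,
glue, rates, unit-mass rescaling, ideal-gas bridge). That file states the item's signature verbatim because, when it
landed, the route file rendered no decl named `TypeOneIdealImplosion`; the route file now does (rev ≥ 13), and the
ledger item is still open. This file restates the theorem against the route decl BY NAME so that the item closes.
Axioms `propext`, `Classical.choice`, `Quot.sound`.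

prover-line-stmt-AtomisticToContinuum-3091-c5-0 (route hygiene while leading the sibling crux stmt-3091).
-/

noncomputable section

namespace Summit.AtomisticToContinuum.HydrodynamicLimit.Theorems

/-- **`TypeOneIdealImplosion` (stmt-AtomisticToContinuum-15146) holds** — the tree theorem
`typeOneIdealImplosion_holds`, against the route decl by name.
[cite: CaolaboraEtAl2025, Thm 1.2 + Rem 1.4 + Rem 1.5] [cite: BuckmasterCaolaboraGomezserrano2025, Thm 1.1, Prop. 3.1] -/
theorem typeOneIdealImplosion_closes :
    Summit.AtomisticToContinuum.HydrodynamicLimit.Theses.ImplosionDichotomy.TypeOneIdealImplosion :=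
  typeOneIdealImplosion_holds

end Summit.AtomisticToContinuum.HydrodynamicLimit.Theorems

end
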